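import Summits.Ventures.YMGap.RobustBall.TransferGap
import Summits.Ventures.YMGap.SlabAreaLawDimensions
import Summits.Ventures.YMGap.Thresholds.ImprovedThresholdSU3PV2
import Literature.MathematicalPhysics.QuantumFieldTheory.Balaban1983to89.StrongCouplingKernelWindow
import Literature.MathematicalPhysics.QuantumFieldTheory.Balaban1983to89.StrongCouplingTorusWindow
import HarnessLib

/-!
# Robust ball (Y2) — the infinite-volume transfer gap from VOLUME-UNIFORM TORUS clustering; the YangMills summit's
# `TorusClusteringAt` discharged at strong coupling

HONEST FRAMING: venture file of the cell `pub-ymgap` (QuantumFields programme), track ROBUST-BALL, seat rb-p2 (g12); sequel of `TransferGap`.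
LATTICE statements at STRONG COUPLING (the Kantorovich–Rubinstein / Dobrushin window of the one-link modulus); rates are Dobrushin row-sum
rates (`krRate c = −log max(c, 1/2)`), weaker than the axis rates of `TransferGapSharp`; nothing about `β → ∞`, the continuum or Clay.

WHAT IS NEW.
* `hasInfiniteVolumeGap_of_torusClusteringAt` — the YangMills summit's re-quantisation composite RQ (`CriticalContinuumLimit.stub_admissibleGivesGap`:
  `TorusClusteringAt r β m → HasInfiniteVolumeGap r β m`) WITHOUT its hypothesis `IsCompactSimpleLieGroup G`: for every compact second-countable
  `G`, every lattice representation `r`, `β ≥ 0`, `m > 0`.  (That hypothesis is used there only to obtain `CylinderApprox`/`CylinderExt` and second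
  countability, which `ClusteringToYangMills.cylinderApprox/Ext_of_secondCountable` give directly; for `SU(N)` it would drag in the unproved Literature
  fact `isSimpleCompactGroup_specialUnitaryGroup`.)  The torus-limit step `clustering_osMatrix_of_torus` is adapted from the (private)
  `clustering_contPosTimeObs` of `FradkinShenkerFlowClusteringToYangMillsStubGapFromClustering`.
* `torusClusteringAt_of_exponentialClustering` — the crossover ledger's `ExponentialClustering r.ρ β m` (pub-balaban, `StrongCouplingTorusWindow`:
  clustering of ALL bounded measurable gauge-invariant local observables on the tori `(2S+1)⁴`, `S ≥ S₀`) gives `TorusClusteringAt r β m` (the small tori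
  are absorbed in the constant).
* Hence (`torusClusteringAt_of_oneLinkKRModulus`, every `SU(N)`; ★★ `su2_torusClusteringAt`, `su2_hasInfiniteVolumeGap_torus`): for `SU(2)`, `d = 4`,
  HYPOTHESIS-FREE on `0 ≤ β_W < 2/9`, `TorusClusteringAt (fundamentalLatticeRep 2) (β_W/2) (krRate (9β_W/2))` — volume-uniform exponential clustering
  in Euclidean time of every pair of gauge-invariant local observables on EVERY odd torus (Jaffe–Witten's "uniform gap for the finite-volume
  approximations", at strong coupling) — and `HasInfiniteVolumeGap (fundamentalLatticeRep 2) (β_W/2) (krRate (9β_W/2))`, no DLR uniqueness used.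
0 sorry, 0 definitions.  References: Osterwalder–Seiler 1978 §2; Glimm–Jaffe 1987 §6.1, §19.7; Föllmer 1988 Ch. I Thm. (2.13).  Everything here is proved. [folklore]
-/

noncomputable section

open scoped BigOperators Topology ENNReal InnerProductSpace ComplexConjugate
open MeasureTheory Filter ProbabilityTheory
open Literature.MathematicalPhysics.QuantumFieldTheory Literature.MathematicalPhysics.QuantumLattice
open Literature.Probability.LatticeModels (IsOSReconstructible IsBoundedMeasurable positiveEvents TransferData)
open Summit.QuantumFields.YangMills.Theorems.ClusteringToYangMills
open Summit.QuantumFields.YangMills.Theorems.ClusteringToYangMills.Reconstructible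
open Summit.QuantumFields.YangMills.Theorems.CriticalContinuumLimit
open Literature.MathematicalPhysics.QuantumFieldTheory.Balaban1983to89
open Literature.MathematicalPhysics.QuantumFieldTheory.Balaban1983to89.StrongCouplingDobrushinWindow (OneLinkKRModulus)

namespace Summit.Ventures.YMGap.RobustBall.TransferGap

/-! ### Volume-uniform torus clustering ⇒ clustering of the OS matrix elements of the limit state -/

section Torus

variable {G : Type} [Group G] [TopologicalSpace G] [IsTopologicalGroup G] [CompactSpace G] [MeasurableSpace G] [BorelSpace G]

omit [TopologicalSpace G] [IsTopologicalGroup G] [CompactSpace G] [BorelSpace G] in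
/-- **The reflected species**: for a gauge-invariant local observable `A`, `A ∘ Θ` is again one (reflected support; gauge invariance by
`AdmissibleGap.gaugeTimeReflect_gaugeTransformZd`). [folklore] -/
theorem exists_species_comp_gaugeTimeReflect [MeasurableInv G] (A : YMSpecies G) : ∃ A' : YMSpecies G, ∀ U, A'.F U = A.F (gaugeTimeReflect U) := by
  -- adapted from the (private) lemma of the same name in
  -- Summits/QuantumFields/YangMills/Theorems/FradkinShenkerFlowClusteringToYangMillsStubGapFromClustering.lean
  obtain ⟨C, hC⟩ := A.bounded
  refine ⟨{ F := A.F ∘ gaugeTimeReflect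
            supp := _
            isCylinder := isCylinder_comp_gaugeTimeReflect A.isCylinder
            gaugeInvariant := fun g U => ?_
            bounded := ⟨C, fun U => hC _⟩
            measurable := A.measurable.comp measurable_gaugeTimeReflect }, fun U => rfl⟩
  show A.F (gaugeTimeReflect (gaugeTransformZd g U)) = A.F (gaugeTimeReflect U)
  rw [AdmissibleGap.gaugeTimeReflect_gaugeTransformZd]
  exact A.gaugeInvariant _ _

/-- **Volume-uniform torus clustering passes to the OS matrix elements of an odd-torus limit state**: for continuous positive-time
species `A, B`, `⟪ι A, Tᵗ ι B⟫ − ⟪ι A, Ω⟫⟪Ω, ι B⟫` is the limit along the odd tori `2S_k+1` of `latticeConnectedCorr r.ρ β (2S_k+1) (A∘Θ) B t`,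
hence `≤ C e^{-mt}` under `TorusClusteringAt r β m`. [folklore] -/
theorem clustering_osMatrix_of_torus (r : LatticeRep G) {β m : ℝ} (hcl : TorusClusteringAt r β m)
    {μ : Measure (LGConfig 4 G)} [IsProbabilityMeasure μ] (hμ : μ ∈ oddTorusLimitPoints r β)
    (h : IsOSReconstructible μ gaugeTimeReflect gaugeTimeShift (posTimeEvents G))
    {A B : LGConfig 4 G → ℂ} (hA : A ∈ contPosTimeObs G) (hB : B ∈ contPosTimeObs G) :
    ∃ C : ℝ, ∀ t : ℕ,
      ‖⟪h.osMap A, (h.transferData.T ^ t) (h.osMap B)⟫_ℂ -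
          ⟪h.osMap A, h.transferData.vacuum⟫_ℂ * ⟪h.transferData.vacuum, h.osMap B⟫_ℂ‖ ≤
        C * Real.exp (-m * t) := by
  -- adapted from the (private) `clustering_contPosTimeObs` of
  -- Summits/QuantumFields/YangMills/Theorems/FradkinShenkerFlowClusteringToYangMillsStubGapFromClustering.lean
  have hAbm := isBoundedMeasurable_posTimeEvents_of_mem hA
  have hBbm := isBoundedMeasurable_posTimeEvents_of_mem hB
  obtain ⟨A₀, hAc, -, rfl⟩ := hA
  obtain ⟨B₀, hBc, -, rfl⟩ := hB
  obtain ⟨A₁, hA₁⟩ := exists_species_comp_gaugeTimeReflect A₀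
  obtain ⟨C, hC⟩ := hcl A₁ B₀
  obtain ⟨S, hS, hlim⟩ := hμ
  have hA₁c : Continuous A₁.F := by
    have e : A₁.F = A₀.F ∘ gaugeTimeReflect := funext hA₁
    rw [e]
    exact hAc.comp continuous_gaugeTimeReflect
  obtain ⟨CA, hCA⟩ := A₁.bounded
  obtain ⟨CB, hCB⟩ := B₀.bounded
  refine ⟨C, fun t => ?_⟩
  have hOS := h.isOSRealisation
  rw [← hOS.integral_conj_comp_reflect_mul_comp_iterate hAbm hBbm t, ← hOS.integral_conj_comp_reflect hAbm,
    ← hOS.integral_eq_inner_vacuum hBbm]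
  simp only [Complex.conj_ofReal, ← Complex.ofReal_mul, integral_complex_ofReal, ← Complex.ofReal_sub, Complex.norm_real,
    Real.norm_eq_abs, iterate_gaugeTimeShift_eq]
  have hΨcyl : IsCylinder (fun U => A₁.F U * B₀.F (configShift (-Pi.single 0 (t : ℤ)) U)) _ :=
    IsCylinder.mul A₁.isCylinder (IsCylinder.comp_configShift B₀.isCylinder _)
  have hΨc : Continuous fun U => A₁.F U * B₀.F (configShift (-Pi.single 0 (t : ℤ)) U) :=
    hA₁c.mul (hBc.comp (continuous_configShift _))
  have hΨb : ∃ C, ∀ U, |A₁.F U * B₀.F (configShift (-Pi.single 0 (t : ℤ)) U)| ≤ C :=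
    ⟨CA * CB, fun U => by
      rw [abs_mul]
      exact mul_le_mul (hCA U) (hCB _) (abs_nonneg _) ((abs_nonneg _).trans (hCA U))⟩
  have t1 := hlim.2 _ _ hΨcyl hΨc hΨb
  have t2 := hlim.2 _ _ A₁.isCylinder hA₁c ⟨CA, hCA⟩
  have t3 := hlim.2 _ _ B₀.isCylinder hBc ⟨CB, hCB⟩
  have T : Tendsto (fun k => latticeConnectedCorr r.ρ β (2 * S k + 1) A₁.F B₀.F t) atTop
      (𝓝 ((∫ U, A₁.F U * B₀.F (configShift (-Pi.single 0 (t : ℤ)) U) ∂μ) - (∫ U, A₁.F U ∂μ) * ∫ U, B₀.F U ∂μ)) :=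
    t1.sub (t2.mul t3)
  have hev : ∀ᶠ k in atTop, |latticeConnectedCorr r.ρ β (2 * S k + 1) A₁.F B₀.F t| ≤ C * Real.exp (-(m * t)) :=
    (eventually_ge_atTop t).mono fun k hk => hC (S k) t (hk.trans hS.le_apply)
  have key := le_of_tendsto T.abs hev
  simpa only [hA₁, neg_mul] using key

variable [SecondCountableTopology G]

/-- ★★ **VOLUME-UNIFORM TORUS CLUSTERING ⇒ INFINITE-VOLUME TRANSFER GAP, for every compact second-countable gauge group** (the YangMills summit's
re-quantisation composite without `IsCompactSimpleLieGroup`): `TorusClusteringAt r β m`, `β ≥ 0`, `m > 0` ⇒ `HasInfiniteVolumeGap r β m` — every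
odd-torus limit state is Osterwalder–Schrader reconstructible (`AdmissibleGap.isOSReconstructible_of_oddTorusLimit`) and `‖T|_{Ω^⊥}‖ ≤ e^{-m}`
(`gapNorm_le_exp_of_dense_clustering` on the dense span of the continuous gauge-invariant positive-time species, `AdmissibleGap.dense_osMap_span`).
(Glimm–Jaffe 1987 Thm. 6.1.3 (iii), §19.7; Osterwalder–Seiler 1978 §2.) [folklore] -/
theorem hasInfiniteVolumeGap_of_torusClusteringAt (r : LatticeRep G) {β m : ℝ} (hβ : 0 ≤ β) (hm : 0 < m)
    (hcl : TorusClusteringAt r β m) : HasInfiniteVolumeGap r β m := by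
  intro μ _ hμ
  have hAP : CylinderApprox μ := cylinderApprox_of_secondCountable G μ
  have hExt : CylinderExt G := cylinderExt_of_secondCountable G
  have h : IsOSReconstructible μ gaugeTimeReflect gaugeTimeShift (posTimeEvents G) :=
    AdmissibleGap.isOSReconstructible_of_oddTorusLimit r hβ μ hμ hAP hExt
  refine ⟨h, hm, gapNorm_le_exp_of_dense_clustering h.transferData m (AdmissibleGap.dense_osMap_span r hμ hAP hExt h) ?_⟩
  rintro _ ⟨F, hF, rfl⟩
  have hv := osMap_mem_span_contPosTimeObs h hF
  refine clustering_span_of_pairs h.transferData m ?_ hv hv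
  rintro _ ⟨A, hA, rfl⟩ _ ⟨B, hB, rfl⟩
  exact clustering_osMatrix_of_torus r hcl hμ h hA hB

end Torus

/-! ### `TorusClusteringAt` from the crossover ledger's `ExponentialClustering` -/

section Ledger

variable {G : Type} [Group G] [TopologicalSpace G] [IsTopologicalGroup G] [CompactSpace G] [MeasurableSpace G] [BorelSpace G]

/-- A connected torus correlation of two bounded observables is at most `2 M_A M_B` in absolute value. [folklore] -/
theorem abs_latticeConnectedCorr_le_two_mul (r : LatticeRep G) (β : ℝ) (S : ℕ) {A B : LGConfig 4 G → ℝ} {MA MB : ℝ}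
    (hA : ∀ U, |A U| ≤ MA) (hB : ∀ U, |B U| ≤ MB) (n : ℕ) :
    |latticeConnectedCorr r.ρ β (2 * S + 1) A B n| ≤ 2 * (MA * MB) := by
  haveI := isProbabilityMeasure_wilsonMeasure (d := 4) (L := 2 * S + 1) r.ρ r.continuous β
  have hMA : 0 ≤ MA := (abs_nonneg _).trans (hA 1)
  have h1 : |∫ U, A (torusLift (2 * S + 1) U) * B (configShift (-Pi.single 0 (n : ℤ)) (torusLift (2 * S + 1) U))
      ∂(wilsonMeasure (d := 4) (L := 2 * S + 1) r.ρ β)| ≤ MA * MB :=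
    StrongCouplingTorusWindow.abs_integral_le_of_abs_le fun U => by
      rw [abs_mul]; exact mul_le_mul (hA _) (hB _) (abs_nonneg _) hMA
  have h2 : |∫ U, A (torusLift (2 * S + 1) U) ∂(wilsonMeasure (d := 4) (L := 2 * S + 1) r.ρ β)| ≤ MA :=
    StrongCouplingTorusWindow.abs_integral_le_of_abs_le fun U => hA _
  have h3 : |∫ U, B (torusLift (2 * S + 1) U) ∂(wilsonMeasure (d := 4) (L := 2 * S + 1) r.ρ β)| ≤ MB :=
    StrongCouplingTorusWindow.abs_integral_le_of_abs_le fun U => hB _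
  unfold latticeConnectedCorr
  calc _ ≤ |∫ U, A (torusLift (2 * S + 1) U) * B (configShift (-Pi.single 0 (n : ℤ)) (torusLift (2 * S + 1) U))
        ∂(wilsonMeasure (d := 4) (L := 2 * S + 1) r.ρ β)| +
        |(∫ U, A (torusLift (2 * S + 1) U) ∂(wilsonMeasure (d := 4) (L := 2 * S + 1) r.ρ β)) *
          ∫ U, B (torusLift (2 * S + 1) U) ∂(wilsonMeasure (d := 4) (L := 2 * S + 1) r.ρ β)| := abs_sub _ _
    _ ≤ MA * MB + MA * MB := by
        rw [abs_mul]
        exact add_le_add h1 (mul_le_mul h2 h3 (abs_nonneg _) hMA)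
    _ = 2 * (MA * MB) := by ring

/-- **`ExponentialClustering ⇒ TorusClusteringAt`**: the crossover ledger's volume-uniform clustering on the tori `(2S+1)⁴`, `S ≥ S₀(A,B)`, gives the
YangMills summit's `TorusClusteringAt` (all `S`), the finitely many small tori being absorbed into the constant (`2 M_A M_B e^{m S₀}`). [folklore] -/
theorem torusClusteringAt_of_exponentialClustering (r : LatticeRep G) {β m : ℝ}
    (h : CrossoverLedger.ExponentialClustering r.ρ β m) : TorusClusteringAt r β m := by
  intro A B
  obtain ⟨C, S₀, hC⟩ := h.2 A B
  obtain ⟨MA, hMA⟩ := A.bounded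
  obtain ⟨MB, hMB⟩ := B.bounded
  refine ⟨max C (2 * (MA * MB) * Real.exp (m * S₀)), fun S n hn => ?_⟩
  by_cases hS : S₀ ≤ S
  · exact (hC S hS n hn).trans (mul_le_mul_of_nonneg_right (le_max_left _ _) (Real.exp_nonneg _))
  · have hlt : n < S₀ := lt_of_le_of_lt hn (not_le.1 hS)
    have hbd := abs_latticeConnectedCorr_le_two_mul r β S hMA hMB n
    have hMAB : 0 ≤ 2 * (MA * MB) := by
      have := (abs_nonneg _).trans (hMA 1); have := (abs_nonneg _).trans (hMB 1); positivity
    have hexp : 1 ≤ Real.exp (m * S₀) * Real.exp (-(m * n)) := by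
      rw [← Real.exp_add]
      exact Real.one_le_exp (by have := h.1; nlinarith [show (n : ℝ) ≤ S₀ by exact_mod_cast hlt.le])
    calc |latticeConnectedCorr r.ρ β (2 * S + 1) A.F B.F n| ≤ 2 * (MA * MB) * 1 := by rw [mul_one]; exact hbd
      _ ≤ 2 * (MA * MB) * (Real.exp (m * S₀) * Real.exp (-(m * n))) := mul_le_mul_of_nonneg_left hexp hMAB
      _ = 2 * (MA * MB) * Real.exp (m * S₀) * Real.exp (-(m * n)) := by ring
      _ ≤ max C (2 * (MA * MB) * Real.exp (m * S₀)) * Real.exp (-(m * n)) :=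
          mul_le_mul_of_nonneg_right (le_max_right _ _) (Real.exp_nonneg _)

end Ledger

/-! ### `SU(N)`: the one-link modulus gives `TorusClusteringAt` and the transfer gap at the Dobrushin rate -/

section SUN

variable {N : ℕ}

/-- ★★ **EVERY `SU(N)`, `d = 4`: the one-link Kantorovich–Rubinstein modulus gives `TorusClusteringAt`** (tree coupling `β`): if `(|β|/N)·6 ≤ R`,
`OneLinkKRModulus N R K` and `18 (|β|/N) K ≤ c < 1`, then `TorusClusteringAt (fundamentalLatticeRep N) β (krRate c)` — volume-uniform exponential clustering of
every pair of bounded measurable gauge-invariant local observables on every odd torus (`StrongCouplingTorusWindow.exponentialClustering_of_oneLinkKRModulus`). [folklore] -/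
theorem torusClusteringAt_of_oneLinkKRModulus (hN : 1 ≤ N) {β R K c : ℝ} (hK : 0 ≤ K) (hR : |β| / N * 6 ≤ R)
    (hmod : OneLinkKRModulus N R K) (hc : 18 * (|β| / N) * K ≤ c) (hc1 : c < 1) :
    TorusClusteringAt (fundamentalLatticeRep N) β (StrongCouplingTorusWindow.krRate c) :=
  torusClusteringAt_of_exponentialClustering (fundamentalLatticeRep N)
    (StrongCouplingTorusWindow.exponentialClustering_of_oneLinkKRModulus hN hK hR hmod hc hc1)

/-- ★★ **EVERY `SU(N)`, `d = 4`, `β ≥ 0`: the one-link modulus gives the infinite-volume transfer gap at the Dobrushin rate**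
`HasInfiniteVolumeGap (fundamentalLatticeRep N) β (krRate c)` (no DLR uniqueness used). [folklore] -/
theorem hasInfiniteVolumeGap_of_oneLinkKRModulus (hN : 1 ≤ N) {β R K c : ℝ} (hβ : 0 ≤ β) (hK : 0 ≤ K) (hR : |β| / N * 6 ≤ R)
    (hmod : OneLinkKRModulus N R K) (hc : 18 * (|β| / N) * K ≤ c) (hc1 : c < 1) :
    HasInfiniteVolumeGap (fundamentalLatticeRep N) β (StrongCouplingTorusWindow.krRate c) := by
  haveI : SecondCountableTopology (Matrix (Fin N) (Fin N) ℂ) :=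
    inferInstanceAs (SecondCountableTopology (Fin N → Fin N → ℂ))
  haveI : SecondCountableTopology (Matrix.specialUnitaryGroup (Fin N) ℂ) :=
    Topology.IsEmbedding.subtypeVal.secondCountableTopology
  exact hasInfiniteVolumeGap_of_torusClusteringAt (fundamentalLatticeRep N) hβ (StrongCouplingTorusWindow.krRate_pos hc1)
    (torusClusteringAt_of_oneLinkKRModulus hN hK hR hmod hc hc1)

/-- ★★ **`SU(2)`, `d = 4`, HYPOTHESIS-FREE, every `0 ≤ β_W < 2/9` (tree coupling `β_W/2`): VOLUME-UNIFORM CLUSTERING ON ALL ODD TORI**,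
`TorusClusteringAt (fundamentalLatticeRep 2) (β_W/2) (krRate (9β_W/2))` — the YangMills summit's hypothesis `TorusClusteringAt`, discharged at strong
coupling from the quarter modulus `OneLinkKRModulus 2 R 1` (`SlabAreaLawDimensions.su2_oneLinkKRModulus_of_le_one`); rate `log(2/(9β_W))` for
`β_W ≥ 1/9`, `log 2` below. [folklore] -/
theorem su2_torusClusteringAt {βW : ℝ} (h0 : 0 ≤ βW) (h : βW < 2 / 9) :
    TorusClusteringAt (fundamentalLatticeRep 2) (βW / 2) (StrongCouplingTorusWindow.krRate (9 * βW / 2)) := by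
  have habs : |βW / 2| = βW / 2 := abs_of_nonneg (by positivity)
  refine torusClusteringAt_of_oneLinkKRModulus (N := 2) (by norm_num) zero_le_one (R := 3 * βW / 2) ?_
    (SlabAreaLawDimensions.su2_oneLinkKRModulus_of_le_one (by linarith)) ?_ (by linarith)
  · rw [habs]; push_cast; linarith
  · rw [habs]; push_cast; linarith

/-- ★★ **`SU(2)`, `d = 4`, HYPOTHESIS-FREE, every `0 ≤ β_W < 2/9`: the infinite-volume transfer gap at the Dobrushin rate, from the tori**,
`HasInfiniteVolumeGap (fundamentalLatticeRep 2) (β_W/2) (krRate (9β_W/2))` (no uniqueness used; at `β_W = 1/8`: gap `≥ log(16/9) ≈ 0.575`, cf. the axis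
rate `log(49/4)` of `TransferGapSharp`). [folklore] -/
theorem su2_hasInfiniteVolumeGap_torus {βW : ℝ} (h0 : 0 ≤ βW) (h : βW < 2 / 9) :
    HasInfiniteVolumeGap (fundamentalLatticeRep 2) (βW / 2) (StrongCouplingTorusWindow.krRate (9 * βW / 2)) := by
  have habs : |βW / 2| = βW / 2 := abs_of_nonneg (by positivity)
  refine hasInfiniteVolumeGap_of_oneLinkKRModulus (N := 2) (by norm_num) (by positivity) zero_le_one (R := 3 * βW / 2) ?_
    (SlabAreaLawDimensions.su2_oneLinkKRModulus_of_le_one (by linarith)) ?_ (by linarith)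
  · rw [habs]; push_cast; linarith
  · rw [habs]; push_cast; linarith

/-- ★★ **EVERY `SU(N)`, `N ≥ 2`, `d = 4`, HYPOTHESIS-FREE (Bakry–Émery modulus) on Shen–Zhu–Zhu's printed window 't Hooft `0 ≤ b < 1/48`**:
`TorusClusteringAt (fundamentalLatticeRep N) (N b) (krRate (18b/(1/2 − 6b)))` and the transfer gap `HasInfiniteVolumeGap (fundamentalLatticeRep N) (N b) (krRate (18b/(1/2 − 6b)))`. [folklore] -/
theorem suN_torusClusteringAt_bakryEmery (hN : 2 ≤ N) {b : ℝ} (hb0 : 0 ≤ b) (hb : b < 1 / 48) :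
    TorusClusteringAt (fundamentalLatticeRep N) ((N : ℝ) * b) (StrongCouplingTorusWindow.krRate (18 * b / (1 / 2 - 6 * b))) ∧
      HasInfiniteVolumeGap (fundamentalLatticeRep N) ((N : ℝ) * b) (StrongCouplingTorusWindow.krRate (18 * b / (1 / 2 - 6 * b))) := by
  have hN0 : (0 : ℝ) < N := by exact_mod_cast (show 0 < N by omega)
  have habs : |(N : ℝ) * b| / N = b := by rw [abs_of_nonneg (by positivity)]; field_simp
  have hR : 6 * b < 1 / 2 := by linarith
  have hden : 0 < 1 / 2 - 6 * b := by linarith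
  have hK : (0 : ℝ) ≤ 1 / (1 / 2 - 6 * b) := by positivity
  have hc1 : 18 * b / (1 / 2 - 6 * b) < 1 := by rw [div_lt_one hden]; linarith
  have hRle : |(N : ℝ) * b| / N * 6 ≤ 6 * b := by rw [habs]; linarith
  have hc : 18 * (|(N : ℝ) * b| / N) * (1 / (1 / 2 - 6 * b)) ≤ 18 * b / (1 / 2 - 6 * b) := by rw [habs]; exact le_of_eq (by field_simp)
  exact ⟨torusClusteringAt_of_oneLinkKRModulus (by omega) hK hRle (StrongCouplingKernelWindow.oneLinkKRModulus_SU hN hR) hc hc1,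
    hasInfiniteVolumeGap_of_oneLinkKRModulus (by omega) (by positivity) hK hRle (StrongCouplingKernelWindow.oneLinkKRModulus_SU hN hR) hc hc1⟩

/-- ★★ **`SU(3)`, `d = 4`, HYPOTHESIS-FREE (certified PV2 modulus `OneLinkKRModulus 3 (1/5) (2679/1250)`) on `0 ≤ β_W < 625/2679 ≈ 0.233`** (tree coupling `β_W/3`):
`TorusClusteringAt (fundamentalLatticeRep 3) (β_W/3) (krRate (2679β_W/625))` and `HasInfiniteVolumeGap (fundamentalLatticeRep 3) (β_W/3) (krRate (2679β_W/625))`. [folklore] -/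
theorem su3_torusClusteringAt_pv2 {βW : ℝ} (h0 : 0 ≤ βW) (h : βW < 625 / 2679) :
    TorusClusteringAt (fundamentalLatticeRep 3) (βW / 3) (StrongCouplingTorusWindow.krRate (2679 * βW / 625)) ∧
      HasInfiniteVolumeGap (fundamentalLatticeRep 3) (βW / 3) (StrongCouplingTorusWindow.krRate (2679 * βW / 625)) := by
  have habs : |βW / 3| / ((3 : ℕ) : ℝ) = βW / 9 := by rw [abs_of_nonneg (by positivity)]; push_cast; ring
  have hRle : |βW / 3| / ((3 : ℕ) : ℝ) * 6 ≤ 1 / 5 := by rw [habs]; linarith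
  have hc : 18 * (|βW / 3| / ((3 : ℕ) : ℝ)) * (2679 / 1250) ≤ 2679 * βW / 625 := by rw [habs]; linarith
  have hc1 : 2679 * βW / 625 < 1 := by rw [div_lt_one (by norm_num)]; linarith
  exact ⟨torusClusteringAt_of_oneLinkKRModulus (by norm_num) (by norm_num) hRle OneLinkVarianceSDC.su3_oneLinkKRModulus_pv2_oneFifth hc hc1,
    hasInfiniteVolumeGap_of_oneLinkKRModulus (by norm_num) (by positivity) (by norm_num) hRle
      OneLinkVarianceSDC.su3_oneLinkKRModulus_pv2_oneFifth hc hc1⟩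

end SUN

end Summit.Ventures.YMGap.RobustBall.TransferGap

end
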